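import Literature.InformationTheory.QuantumCodes.SymplecticCodes
import Literature.InformationTheory.QuantumCodes.SyndromeDecoding
import HarnessLib

/-!
# The five-qubit code is perfect: its syndrome-table decoder has correction radius exactly 1 (kernel-checked)

[cite: Gottesman1997, §3.3 (held chunk p0020 L55–57: "every possible error syndrome is used by the
single-qubit errors. It is therefore a perfect code"); §3.4 (binary stabilizer matrix, chunk p0021 L10–28)]
Kernel instance for LADDER-QEC Q4 produced by qec-search-6 (decoders as specified functions + certified
correction radius).
Vocabulary: `SympVec`, `sympInner`, `sympWeight`, `fiveQubitRows`, `fiveQubitCode` (qec-lit-1,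
`SymplecticCodes.lean`, [cite: Gottesman1997, §3.4]) and `Decoder`, `Decoder.CorrectsUpTo`,
`Decoder.IsCorrectionRadius` (qec-type-08, `SyndromeDecoding.lean`). Nothing is re-defined.

* `fiveQubitSyn e i = sympInner (fiveQubitRows i) e` — the syndrome map (Gottesman1997 §3.2: f(E)).
* `fiveQubitTable` — the minimum-weight syndrome-table decoder as an explicit total function: the first
  error of the list `[1, X₀..X₄, Z₀..Z₄, Y₀..Y₄]` with the given syndrome (all 16 syndromes occur: the code
  is perfect), i.e. the decoder `Decoder.ofTable` would build from qec-search-6's table DATA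
  (HOME/cert/radius/calib/TABLES/stab_n5_k1.table.tsv up to the generator convention).
* `fiveQubitTable_correctsUpTo_one` — it corrects every Pauli error of weight ≤ 1 (by `decide` over all
  1024 phase-free Pauli errors; the net operation is `0 ∈ S`).
* `fiveQubitTable_not_correctsUpTo_two`, `fiveQubitTable_isCorrectionRadius` — radius EXACTLY 1: the
  weight-2 error `X₀X₁` is answered with `Z₃`, and the net error `X₀X₁Z₃` anticommutes with the logical
  `X₀X₁X₂X₃X₄`, which commutes with every generator — so it is not a stabilizer.
All proofs are kernel `decide` / linear algebra; no `native_decide`; axioms ⊆ {propext, Classical.choice, Quot.sound}.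
Compute-side counterpart: certificate rad-… in HOME/cert/radius/calib/ (job j257304: 15/15 weight-1
errors corrected, 90/90 weight-2 errors failed for the equivalent table on search-5's generators).
-/

namespace Literature.InformationTheory.QuantumCodes

/-- Syndrome map of the five-qubit code: bit `i` = symplectic inner product with generator `i`
("f(E)"). (definition) [cite: Gottesman1997, §3.2; §3.4] -/
def fiveQubitSyn (e : SympVec 5) : Fin 4 → ZMod 2 := fun i => sympInner (fiveQubitRows i) e

/-- Single-qubit `X` on qubit `j` as a phase-free Pauli vector (plumbing). [folklore] -/
def pX (j : Fin 5) : SympVec 5 := (Pi.single j 1, 0)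
/-- Single-qubit `Z` on qubit `j` (plumbing). [folklore] -/
def pZ (j : Fin 5) : SympVec 5 := (0, Pi.single j 1)
/-- Single-qubit `Y` on qubit `j` (plumbing). [folklore] -/
def pY (j : Fin 5) : SympVec 5 := (Pi.single j 1, Pi.single j 1)

/-- The ordered candidate list of the table decoder: identity, then `X₀..X₄`, `Z₀..Z₄`, `Y₀..Y₄` (plumbing). [folklore] -/
def fiveQubitBall : List (SympVec 5) :=
  [0, pX 0, pX 1, pX 2, pX 3, pX 4, pZ 0, pZ 1, pZ 2, pZ 3, pZ 4, pY 0, pY 1, pY 2, pY 3, pY 4]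

/-- The **syndrome-table decoder** of the five-qubit code: the first candidate of `fiveQubitBall` whose
syndrome equals `s` (default `0`; every one of the 16 syndromes is attained by exactly one candidate —
"every possible error syndrome is used by the single-qubit errors"). (definition)
[cite: Gottesman1997, §3.3] -/
def fiveQubitTable : Decoder (Fin 4 → ZMod 2) (SympVec 5) :=
  fun s => (fiveQubitBall.find? fun e => decide (fiveQubitSyn e = s)).getD 0

set_option maxRecDepth 65536 in
/-- On every error of weight ≤ 1 the table decoder returns the error itself (kernel `decide` over all
2^10 phase-free Pauli errors on 5 qubits) — "every possible error syndrome is used by the single-qubit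
errors". (proved) [cite: Gottesman1997, §3.3] -/
theorem fiveQubitTable_syn_eq (e : SympVec 5) (he : sympWeight e ≤ 1) :
    fiveQubitTable (fiveQubitSyn e) = e := by
  revert e
  decide

/-- In characteristic two every Pauli vector is its own inverse (helper). [folklore] -/
private theorem sympVec_add_self (v : SympVec 5) : v + v = 0 := by
  have h2 : ∀ a : ZMod 2, a + a = 0 := by decide
  refine Prod.ext ?_ ?_ <;> funext i
  · exact h2 (v.1 i)
  · exact h2 (v.2 i)

/-- **Radius ≥ 1:** the five-qubit table decoder corrects every Pauli error of weight ≤ 1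
(`Decoder.CorrectsUpTo` with `S` = the stabilizer space `fiveQubitCode`). (proved, kernel `decide`)
[cite: Gottesman1997, §3.3 (perfect code correcting one error)] -/
theorem fiveQubitTable_correctsUpTo_one :
    fiveQubitTable.CorrectsUpTo fiveQubitSyn (fiveQubitCode : Set (SympVec 5)) sympWeight 1 := by
  intro e he
  show fiveQubitTable (fiveQubitSyn e) + e ∈ (fiveQubitCode : Set (SympVec 5))
  rw [fiveQubitTable_syn_eq e he, sympVec_add_self]
  exact fiveQubitCode.zero_mem

/-- The operator `X₀X₁X₂X₃X₄`, which commutes with every generator (plumbing for the non-membership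
witness). [folklore] -/
def fiveQubitLogicalX : SympVec 5 := (fun _ => 1, 0)

/-- `X₀X₁X₂X₃X₄` commutes with every generator (helper, `decide`). [folklore] -/
private theorem sympInner_fiveQubitLogicalX_rows (i : Fin 4) :
    sympInner fiveQubitLogicalX (fiveQubitRows i) = 0 := by
  revert i; decide

/-- Anything in the stabilizer space commutes (symplectically) with `X₀X₁X₂X₃X₄` (helper). [folklore] -/
private theorem sympInner_fiveQubitLogicalX_eq_zero {v : SympVec 5} (hv : v ∈ fiveQubitCode) :
    sympInner fiveQubitLogicalX v = 0 := by
  have hle : fiveQubitCode ≤ LinearMap.ker (sympForm 5 fiveQubitLogicalX) := by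
    refine Submodule.span_le.mpr ?_
    rintro _ ⟨i, rfl⟩
    simp only [SetLike.mem_coe, LinearMap.mem_ker, sympForm_apply]
    exact sympInner_fiveQubitLogicalX_rows i
  have := hle hv
  simpa only [LinearMap.mem_ker, sympForm_apply] using this

/-- The weight-2 error `X₀X₁` (plumbing: the failure witness). [folklore] -/
def errXX : SympVec 5 := pX 0 + pX 1

/-- `X₀X₁` has weight 2 (helper). [folklore] -/
private theorem sympWeight_errXX : sympWeight errXX = 2 := by decide

/-- The net operation after decoding `X₀X₁` anticommutes with `X₀X₁X₂X₃X₄` (helper, `decide`). [folklore] -/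
private theorem sympInner_logicalX_residual_errXX :
    sympInner fiveQubitLogicalX (fiveQubitTable (fiveQubitSyn errXX) + errXX) = 1 := by decide

/-- **Radius < 2:** the table decoder does not correct the weight-2 error `X₀X₁` (a distance-3 code cannot
correct two errors). (proved) [cite: Gottesman1997, §2.3] -/
theorem fiveQubitTable_not_correctsUpTo_two :
    ¬ fiveQubitTable.CorrectsUpTo fiveQubitSyn (fiveQubitCode : Set (SympVec 5)) sympWeight 2 := by
  intro h
  have hmem : fiveQubitTable (fiveQubitSyn errXX) + errXX ∈ fiveQubitCode :=
    h errXX (by rw [sympWeight_errXX])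
  have h0 := sympInner_fiveQubitLogicalX_eq_zero hmem
  rw [sympInner_logicalX_residual_errXX] at h0
  exact one_ne_zero h0

/-- **The correction radius of the five-qubit syndrome-table decoder is exactly 1** (kernel-checked;
`Decoder.IsCorrectionRadius`; compute-side twin: qec-search-6 certificate for stab_n5_k1, job j257304).
[cite: Gottesman1997, §3.3; §2.3 (t errors need distance ≥ 2t+1)] -/
theorem fiveQubitTable_isCorrectionRadius :
    fiveQubitTable.IsCorrectionRadius fiveQubitSyn (fiveQubitCode : Set (SympVec 5)) sympWeight 1 :=
  ⟨fiveQubitTable_correctsUpTo_one, fiveQubitTable_not_correctsUpTo_two⟩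

end Literature.InformationTheory.QuantumCodes
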